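import Literature.NumberTheory.GaloisRepresentations.ContinuousShapiroLiftMackeyCup
import HarnessLib

/-!
# Mackey's double-coset decomposition of `θ^* Maps(G ⧸ N, X)` in degree one: JOINT BIJECTIVITY of the orbit projections
# `Φ_{g_i N}`, JOINT SURJECTIVITY on `H¹`, orbit DETECTION of Shapiro lifts, and the orbit splitting of the cup product of a
# restricted Shapiro lift with an ARBITRARY class of `D` — companion of `ContinuousShapiroLiftMackeyCup.lean`

Generic continuous group cohomology (no number theory); namespace `Literature.NumberTheory.GaloisRepresentations`.
THEOREMS ONLY (no definition, no named fact, no instance, no notation, no `sorry`).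

Setting (as in `ContinuousShapiroLiftMackeyCup.lean`): `θ : D →ₜ* G` continuous, `N ⊴ G` an open normal subgroup of finite index,
`N_D := θ⁻¹(N)`, `ē : D ⧸ N_D → G ⧸ N` (`quotientMapOfHom`), `X : TopRep R G`, and a family `g : ι → G` of ORBIT REPRESENTATIVES of the
`D`-action on `G ⧸ N`, i.e. `(i, y') ↦ ē(y')·(g_i N)` is a bijection `ι × (D ⧸ N_D) ≃ G ⧸ N` (the double cosets `θ(D) \ G / N`).
The companion file built the projections `Φ_c = resCoindFinHomR X N θ c : Maps(G ⧸ N, X)|_θ ⟶ Maps(D ⧸ N_D, X|_θ)`,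
`(Φ_c F)(y') = F(ē(y')·c)`, and proved Mackey's formula for the cup product of TWO restricted Shapiro lifts. Here:

* §1 **`resCoindFinHomR_jointly_bijective`** — Mackey AT MODULE LEVEL: `F ↦ (Φ_{g_i N} F)_i` is a bijection
  `Maps(G ⧸ N, X) ≃ Π_i Maps(D ⧸ N_D, X)` (`θ^* Ind_N^G X ≅ ⊕_{θ(D) g N} Ind_{N_D}^D θ^* X`, Brown III (5.6)(b)).
* §2 **`map_comapCoeffHom_conjMap_eq_zero_of_map_shapiroLift_eq_zero`** — ORBIT DETECTION: if `θ^*(Sh_N^G a) = 0` in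
  `H¹(D, Maps(G ⧸ N, X)|_θ)` then `θ_N^*(γ · a) = 0` in `H¹(N_D, X|_θ)` for EVERY `γ ∈ G` (apply `H¹(Φ_{γN})`, the companion's
  `map_resCoindFinHomR_shapiroLift`, and injectivity of the Shapiro lift for `(D, N_D)`).
* §3 **`exists_cohomologyMap_resCoindFinHomR_eq`** — Mackey ON `H¹`, JOINT SURJECTIVITY: every tuple
  `c_i ∈ H¹(D, Maps(D ⧸ N_D, X|_θ))` is `(H¹(Φ_{g_i N}) z)_i` for ONE `z ∈ H¹(D, Maps(G ⧸ N, X)|_θ)` — explicit inverse on cocycles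
  `Z(d)(ē(y')·g_i N) := F_i(d)(y')`; `…_eq_shapiroLift` the same with the targets written as Shapiro lifts `Sh_{N_D}^D b_i`.
* §4 **`cupProduct_map_shapiroLift_eq_sum_orbits`** — ORBIT SPLITTING OF THE CUP PRODUCT WITH AN ARBITRARY SECOND FACTOR:
  for `a ∈ H¹(N, X)`, a continuous equivariant pairing `P : X × Y → Z` and ANY `u ∈ H¹(D, Maps(G ⧸ N, Y)|_θ)`,
  `θ^*(Sh_N^G a) ∪_{ΣP|_θ} u = Σ_i Sh_{N_D}^D(θ_N^*(g_i · a)) ∪_{ΣP|_θ, N_D} H¹(Φ_{g_i N}) u` in `H²(D, Z|_θ)` — the companion's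
  `map_cupProduct_coindFin_shapiroLift_sum` is the case `u = θ^*(Sh_N^G b)`.
* §5 (appended) **`exists_orbitReps_bijective`** — orbit representatives EXIST: for `N ⊴ G` of finite index the `hbij`
  hypothesis of §1, §3, §4 (and of the companion's Mackey formula) is satisfiable with a finite `ι` (`ι := Ḡ ⧸ H̄`, `H̄ = θ(D)N/N`).
* §6 (appended) `cupProduct_restrict_coindFin_eq_sum_orbits` — orbit splitting of `x ∪ u` for TWO arbitrary classes of `D` (§4 is
  `x = θ^*(Sh a)`): the local Tate pairing of `Maps(G ⧸ N, M)` at a place with several orbits is the sum of the layer pairings of the components.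

Consumer (why the arbitrary `u` and the joint surjectivity matter): Poitou–Tate arguments in the Shapiro model over the layers `ℚ_n` of a
`ℤ_p`-tower at a prime `ℓ` that SPLITS in `ℚ_n` (`G = Γ_ℚ`, `N = Γ_{ℚ_n}`, `D = Γ_{ℚ_ℓ}`, `ι` = the places of `ℚ_n` above `ℓ`): a LOCAL class
`u_ℓ ∈ H¹(ℚ_ℓ, Maps(Γ_ℚ ⧸ Γ_n, A))` with PRESCRIBED components at the places above `ℓ` exists by §3, and its local Tate pairing against the
restriction of a global Shapiro lift is the sum of the place-wise layer pairings by §4 (cell `bsd-wall`, crux RSL_g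
`ResidualSignedLambdaLowerCMAtTwo` of `Summits/BirchSwinnertonDyer`, card `stub-cmlambdalower-k3-g11`, whose kernel-checked sketch these
proofs transcribe). Nothing about BSD is proved here.

## References
* K. S. Brown, *Cohomology of Groups* (1982), III §5 (5.6)(b) (restriction of induced modules: the double coset formula), III §6 (6.5),
  V §3. [Brown1982]
* J. Neukirch, A. Schmidt, K. Wingberg, *Cohomology of Number Fields*, 2nd ed. (2008), I §5 Prop. (1.5.3) (iv) (cup products and
  compatible pairs), (1.5.6)–(1.5.7) (double cosets), I §6 Prop. (1.6.4)–(1.6.5) (Shapiro's lemma and cup products). [NeukirchSchmidtWingberg2008]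
* J.-P. Serre, *Local Fields* (1979), VII §5–§6. [SerreLocalFields1979]
-/

noncomputable section

open CategoryTheory

open scoped Classical

universe u v w

namespace Literature.NumberTheory.GaloisRepresentations

open _root_.TopRep

variable {R : Type u} [CommRing R] [TopologicalSpace R]
variable {G : Type v} [Group G] [TopologicalSpace G]
variable {D : Type v} [Group D] [TopologicalSpace D]

/-! ## §1 Mackey at module level: the orbit projections are jointly bijective -/

/-- **Mackey's decomposition at module level.** If `g : ι → G` are orbit representatives of the `D`-action on `G ⧸ N` through `θ`
(`(i, y') ↦ ē(y')·g_i N` bijective), then `F ↦ (Φ_{g_i N} F)_i` is a BIJECTION `Maps(G ⧸ N, X) → Π_i Maps(D ⧸ θ⁻¹N, X)`; each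
`Φ_{g_i N} = resCoindFinHomR X N θ (g_i N)` being a morphism of `D`-representations, this is the isomorphism
`θ^* Ind_N^G X ≅ ⊕_{θ(D) g N} Ind_{θ⁻¹N}^D θ^* X`. [cite: Brown1982, III §5 (5.6)(b)] [cite: NeukirchSchmidtWingberg2008, I §5 (1.5.6)–(1.5.7)] -/
theorem resCoindFinHomR_jointly_bijective (X : TopRep.{v} R G) (N : Subgroup G) [N.Normal] (θ : D →ₜ* G)
    {ι : Type w} (g : ι → G)
    (hbij : Function.Bijective fun q : ι × (D ⧸ N.comap (θ : D →* G)) => quotientMapOfHom N θ q.2 * (g q.1 : G ⧸ N)) :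
    Function.Bijective fun F : coindFin X N => fun i => (resCoindFinHomR X N θ (g i : G ⧸ N)).hom F := by
  classical
  set e : ι × (D ⧸ N.comap (θ : D →* G)) ≃ G ⧸ N := Equiv.ofBijective _ hbij with he
  refine ⟨fun F₁ F₂ h => ?_, fun t => ?_⟩
  · funext y
    obtain ⟨⟨i, y'⟩, rfl⟩ := e.surjective y
    exact congrFun (congrFun h i) y'
  · refine ⟨fun y => t (e.symm y).1 (e.symm y).2, funext fun i => funext fun y' => ?_⟩
    have hsymm : e.symm (quotientMapOfHom N θ y' * (g i : G ⧸ N)) = (i, y') := by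
      rw [Equiv.symm_apply_eq]; rfl
    change (fun y => t (e.symm y).1 (e.symm y).2) (quotientMapOfHom N θ y' * (g i : G ⧸ N)) = t i y'
    dsimp only
    rw [hsymm]

/-! ## §2 Orbit detection: `θ^*(Sh a) = 0` forces `θ_N^*(γ · a) = 0` for every `γ` -/

section Detection

variable [IsTopologicalGroup G] [IsTopologicalGroup D]

/-- **Orbit detection.** If the restriction `θ^*(Sh_N^G a) ∈ H¹(D, Maps(G ⧸ N, X)|_θ)` of a Shapiro lift vanishes, then for EVERY
`γ ∈ G` the class `θ_N^*(γ · a) ∈ H¹(θ⁻¹N, X|_θ)` vanishes: apply `H¹(Φ_{γN})`, rewrite with `map_resCoindFinHomR_shapiroLift`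
(`H¹(θ, Φ_{γN})(Sh a) = Sh^D(θ_N^*(γ · a))`) and use the injectivity of the Shapiro lift for `(D, θ⁻¹N)`. (With `D` a decomposition
group and one orbit this reads «the localisation of `Sh a` vanishes ⟹ the layer localisation of `a` vanishes»; with `D` an inertia group
inside `N` it reads «`Sh a` unramified ⟹ every conjugate of `a` dies on inertia».) [cite: NeukirchSchmidtWingberg2008, I §6 Prop. (1.6.4)–(1.6.5)]
[cite: Brown1982, III §5 (5.6)(b)] -/
theorem map_comapCoeffHom_conjMap_eq_zero_of_map_shapiroLift_eq_zero (X : TopRep.{v} R G) (N : Subgroup G) [N.Normal]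
    (θ : D →ₜ* G) (hN : IsOpen (N : Set G)) {s : G ⧸ N → G} (hs : ∀ y : G ⧸ N, (s y : G ⧸ N) = y)
    (hs1 : s ((1 : G) : G ⧸ N) = 1) {sD : D ⧸ N.comap (θ : D →* G) → D}
    (hsD : ∀ y, (sD y : D ⧸ N.comap (θ : D →* G)) = y) (hsD1 : sD ((1 : D) : D ⧸ N.comap (θ : D →* G)) = 1)
    (a : continuousCohomology 1 (subgroupRep X N))
    (h0 : ContinuousCohomology.map θ (𝟙 (TopRep.res (θ : D →* G) (coindFin X N))) 1 (shapiroLift X N hN hs hs1 a) = 0)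
    (γ : G) :
    ContinuousCohomology.map (comapSubtypeHom N θ) (comapCoeffHom X N θ) 1 (conjMap X N γ 1 a) = 0 := by
  apply shapiroLift_injective (TopRep.res (θ : D →* G) X) (N.comap (θ : D →* G)) (isOpen_comap N θ hN) hsD hsD1
  rw [map_zero, ← map_resCoindFinHomR_shapiroLift X N θ hN hs hs1 hsD hsD1 γ a]
  -- factor `H¹(θ, Φ_{γN}) = H¹(Φ_{γN}) ∘ θ^*` on cocycles, then use `θ^*(Sh a) = 0`
  have hfac : ContinuousCohomology.map θ (resCoindFinHomR X N θ (γ : G ⧸ N)) 1 (shapiroLift X N hN hs hs1 a) =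
      cohomologyMap (resCoindFinHomR X N θ (γ : G ⧸ N)) 1
        (ContinuousCohomology.map θ (𝟙 (TopRep.res (θ : D →* G) (coindFin X N))) 1 (shapiroLift X N hN hs hs1 a)) := by
    obtain ⟨F, hF⟩ := oneCocycleClass_surjective _ (shapiroLift X N hN hs hs1 a)
    rw [← hF, map_oneCocycleClass, map_oneCocycleClass, cohomologyMap_oneCocycleClass]
    rfl
  rw [hfac, h0, map_zero]

end Detection

/-! ## §3 Mackey on `H¹`: joint surjectivity of the orbit projections -/

/-- **The family `(H¹(Φ_{g_i N}))_i` is JOINTLY SURJECTIVE** `H¹(D, θ^* Maps(G ⧸ N, X)) ↠ Π_i H¹(D, Maps(D ⧸ θ⁻¹N, X|_θ))` whenever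
`(i, y') ↦ ē(y')·g_i N` is a bijection `ι × D ⧸ θ⁻¹N ≃ G ⧸ N` (Mackey: the double cosets `θ(D) g_i N`). Explicit inverse on cocycles:
given cocycles `F_i` of the targets, `Z(d)(ē(y')·g_i N) := F_i(d)(y')` is a continuous crossed homomorphism of `D` into
`θ^* Maps(G ⧸ N, X)` with `Φ_{g_i N} ∘ Z = F_i` (the cocycle identity is checked fibrewise through `ē(d⁻¹y')·g_i N = θ(d)⁻¹·(ē(y')·g_i N)`).
With Shapiro for `(D, θ⁻¹N)` this is `H¹(D, θ^* Ind_N^G X) ↠ ⊕_i H¹(θ⁻¹N, g_i^* X)`. [cite: Brown1982, III §5 (5.6)(b) and III §6 (6.5)]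
[cite: NeukirchSchmidtWingberg2008, I §5 (1.5.6)–(1.5.7), I §6 (1.6.4)] -/
theorem exists_cohomologyMap_resCoindFinHomR_eq [IsTopologicalGroup D] (X : TopRep.{v} R G) (N : Subgroup G) [N.Normal]
    (θ : D →ₜ* G) {ι : Type w} (g : ι → G)
    (hbij : Function.Bijective fun q : ι × (D ⧸ N.comap (θ : D →* G)) => quotientMapOfHom N θ q.2 * (g q.1 : G ⧸ N))
    (c : ι → continuousCohomology 1 (coindFin (TopRep.res (θ : D →* G) X) (N.comap (θ : D →* G)))) :
    ∃ z : continuousCohomology 1 (TopRep.res (θ : D →* G) (coindFin X N)),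
      ∀ i, cohomologyMap (resCoindFinHomR X N θ (g i : G ⧸ N)) 1 z = c i := by
  classical
  choose F hF using fun i => oneCocycleClass_surjective _ (c i)
  set e := Equiv.ofBijective _ hbij with he
  have key : ∀ (i : ι) (y' : D ⧸ N.comap (θ : D →* G)) (d : D),
      e.symm ((θ d)⁻¹ • e (i, y')) = (i, d⁻¹ • y') := fun i y' d => by
    rw [Equiv.symm_apply_eq]
    change (θ d)⁻¹ • (quotientMapOfHom N θ y' * (g i : G ⧸ N)) =
      quotientMapOfHom N θ (d⁻¹ • y') * (g i : G ⧸ N)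
    rw [quotientMapOfHom_smul, map_inv, smul_mul_quotient]
  let Zfun : D → TopRep.res (θ : D →* G) (coindFin X N) := fun d y => (F (e.symm y).1).1 d (e.symm y).2
  have hZcont : Continuous Zfun :=
    continuous_pi fun y => (continuous_apply (e.symm y).2).comp (F (e.symm y).1).1.continuous
  have hZ : ∀ (d d' : D) (i : ι) (y' : D ⧸ N.comap (θ : D →* G)),
      Zfun d' ((θ d)⁻¹ • e (i, y')) = (F i).1 d' (d⁻¹ • y') := fun d d' i y' => by
    change (F (e.symm ((θ d)⁻¹ • e (i, y'))).1).1 d' (e.symm ((θ d)⁻¹ • e (i, y'))).2 = _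
    rw [key]
  have hZe : ∀ (d : D) (i : ι) (y' : D ⧸ N.comap (θ : D →* G)), Zfun d (e (i, y')) = (F i).1 d y' := fun d i y' => by
    change (F (e.symm (e (i, y'))).1).1 d (e.symm (e (i, y'))).2 = _
    rw [Equiv.symm_apply_apply]
  let Z : contOneCocycles (TopRep.res (θ : D →* G) (coindFin X N)) :=
    ⟨⟨Zfun, hZcont⟩, fun d d' => by
      funext y
      obtain ⟨⟨i, y'⟩, rfl⟩ := e.surjective y
      have hFi := congrFun ((F i).2 d d') y'
      change Zfun (d * d') (e (i, y')) = Zfun d (e (i, y')) + (coindFin X N).ρ (θ d) (Zfun d') (e (i, y'))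
      rw [coindFin_ρ_apply, hZ, hZe, hZe, hFi]
      rfl⟩
  refine ⟨oneCocycleClass _ Z, fun i => ?_⟩
  rw [← hF i, cohomologyMap_oneCocycleClass]
  congr 1
  refine Subtype.ext (ContinuousMap.ext fun d => funext fun y' => ?_)
  rw [pullback_id_resIdHom_apply, resCoindFinHomR_apply]
  exact hZe d i y'

/-- **Joint surjectivity onto Shapiro-lifted layer classes**: every tuple `b_i ∈ H¹(θ⁻¹N, X|_θ)`, one per orbit, is the tuple of orbit
components of ONE class `z ∈ H¹(D, Maps(G ⧸ N, X)|_θ)` read back through the Shapiro lifts of `(D, θ⁻¹N)`: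
`H¹(Φ_{g_i N}) z = Sh_{θ⁻¹N}^D(b_i)`. [cite: Brown1982, III §5 (5.6)(b) and III §6 (6.5)] [cite: NeukirchSchmidtWingberg2008, I §6 (1.6.4)] -/
theorem exists_cohomologyMap_resCoindFinHomR_eq_shapiroLift [IsTopologicalGroup D] (X : TopRep.{v} R G) (N : Subgroup G)
    [N.Normal] (θ : D →ₜ* G) (hN : IsOpen (N : Set G)) {ι : Type w} (g : ι → G)
    (hbij : Function.Bijective fun q : ι × (D ⧸ N.comap (θ : D →* G)) => quotientMapOfHom N θ q.2 * (g q.1 : G ⧸ N))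
    {sD : D ⧸ N.comap (θ : D →* G) → D} (hsD : ∀ y, (sD y : D ⧸ N.comap (θ : D →* G)) = y)
    (hsD1 : sD ((1 : D) : D ⧸ N.comap (θ : D →* G)) = 1)
    (b : ι → continuousCohomology 1 (subgroupRep (TopRep.res (θ : D →* G) X) (N.comap (θ : D →* G)))) :
    ∃ z : continuousCohomology 1 (TopRep.res (θ : D →* G) (coindFin X N)),
      ∀ i, cohomologyMap (resCoindFinHomR X N θ (g i : G ⧸ N)) 1 z =
        shapiroLift (TopRep.res (θ : D →* G) X) (N.comap (θ : D →* G)) (isOpen_comap N θ hN) hsD hsD1 (b i) :=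
  exists_cohomologyMap_resCoindFinHomR_eq X N θ g hbij fun i =>
    shapiroLift (TopRep.res (θ : D →* G) X) (N.comap (θ : D →* G)) (isOpen_comap N θ hN) hsD hsD1 (b i)

/-! ## §4 Orbit splitting of the cup product of a restricted Shapiro lift with an ARBITRARY class of `D` -/

/-- **Orbit splitting of `θ^*(Sh a) ∪ u` for an ARBITRARY local second factor.** For orbit representatives `g : ι → G`,
`a ∈ H¹(N, X)`, a continuous equivariant pairing `P : X × Y → Z` and ANY `u ∈ H¹(D, Maps(G ⧸ N, Y)|_θ)` (not necessarily the
restriction of a global class): `θ^*(Sh_N^G a) ∪_{ΣP|_θ} u = Σ_i Sh_{θ⁻¹N}^D(θ_N^*(g_i · a)) ∪_{Σ P|_θ, θ⁻¹N} H¹(Φ_{g_i N}) u` in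
`H²(D, Z|_θ)` — naturality of the cup product along the family `(Φ_{g_i N}, Φ_{g_i N})` over `id_D` (`cupProduct_mapPair_sum`, the summed
pairing splitting along the orbits by `coindFin_toLin_sum_resCoindFinHomR`), then `H¹(Φ_{g_i N})(θ^* Sh a) = Sh^D(θ_N^*(g_i · a))`
(`map_resCoindFinHomR_shapiroLift`). The companion's `map_cupProduct_coindFin_shapiroLift_sum` is the case `u = θ^*(Sh_N^G b)`.
[cite: NeukirchSchmidtWingberg2008, I §5 Prop. (1.5.3) (iv), I §6 Prop. (1.6.5)] [cite: Brown1982, III §5 (5.6)(b), V §3] -/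
theorem cupProduct_map_shapiroLift_eq_sum_orbits [IsTopologicalGroup G] [IsTopologicalGroup D] [LocallyCompactSpace G]
    [LocallyCompactSpace D] {X Y Z : TopRep.{v} R G} (P : ContPairing X Y Z) (N : Subgroup G) [N.Normal] (θ : D →ₜ* G)
    [Fintype (G ⧸ N)] [Fintype (D ⧸ N.comap (θ : D →* G))] (hN : IsOpen (N : Set G)) {ι : Type w} [Fintype ι] (g : ι → G)
    (hbij : Function.Bijective fun q : ι × (D ⧸ N.comap (θ : D →* G)) => quotientMapOfHom N θ q.2 * (g q.1 : G ⧸ N))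
    {s : G ⧸ N → G} (hs : ∀ y : G ⧸ N, (s y : G ⧸ N) = y) (hs1 : s ((1 : G) : G ⧸ N) = 1)
    {sD : D ⧸ N.comap (θ : D →* G) → D} (hsD : ∀ y, (sD y : D ⧸ N.comap (θ : D →* G)) = y)
    (hsD1 : sD ((1 : D) : D ⧸ N.comap (θ : D →* G)) = 1)
    (a : continuousCohomology 1 (subgroupRep X N)) (u : continuousCohomology 1 (TopRep.res (θ : D →* G) (coindFin Y N))) :
    ((P.coindFin N).restrict θ).cupProduct
        (ContinuousCohomology.map θ (𝟙 (TopRep.res (θ : D →* G) (coindFin X N))) 1 (shapiroLift X N hN hs hs1 a)) u =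
      ∑ i, ((P.restrict θ).coindFin (N.comap (θ : D →* G))).cupProduct
        (shapiroLift (TopRep.res (θ : D →* G) X) (N.comap (θ : D →* G)) (isOpen_comap N θ hN) hsD hsD1
          (ContinuousCohomology.map (comapSubtypeHom N θ) (comapCoeffHom X N θ) 1 (conjMap X N (g i) 1 a)))
        (cohomologyMap (resCoindFinHomR Y N θ (g i : G ⧸ N)) 1 u) := by
  -- (1) split the `D`-level cup product along the family `Φ_{g_i N}` (naturality along compatible pairs over `id_D`)
  have h1 := ContPairing.cupProduct_mapPair_sum Finset.univ ((P.coindFin N).restrict θ)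
    ((P.restrict θ).coindFin (N.comap (θ : D →* G))) (ContinuousMonoidHom.id D)
    (fun i => resIdHom (resCoindFinHomR X N θ (g i : G ⧸ N))) (fun i => resIdHom (resCoindFinHomR Y N θ (g i : G ⧸ N)))
    (𝟙 (TopRep.res (θ : D →* G) Z))
    (fun F F' => by
      change (P.coindFin N).toLin F F' = _
      rw [ContPairing.coindFin_toLin_sum_resCoindFinHomR P N θ (fun i => (g i : G ⧸ N)) hbij F F']
      rfl)
    (ContinuousCohomology.map θ (𝟙 (TopRep.res (θ : D →* G) (coindFin X N))) 1 (shapiroLift X N hN hs hs1 a)) u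
  -- (2) the left-hand side is the cup product itself
  rw [ContinuousCohomology.map_id] at h1
  change ((P.coindFin N).restrict θ).cupProduct _ u = _ at h1
  -- (3) first factors: `H¹(Φ_{g_i N})(θ^* Sh a) = H¹(θ, Φ_{g_i N})(Sh a) = Sh^D(θ_N^*(g_i · a))`
  have hfac : ∀ i, ContinuousCohomology.map (ContinuousMonoidHom.id D) (resIdHom (resCoindFinHomR X N θ (g i : G ⧸ N))) 1
      (ContinuousCohomology.map θ (𝟙 (TopRep.res (θ : D →* G) (coindFin X N))) 1 (shapiroLift X N hN hs hs1 a)) =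
      shapiroLift (TopRep.res (θ : D →* G) X) (N.comap (θ : D →* G)) (isOpen_comap N θ hN) hsD hsD1
        (ContinuousCohomology.map (comapSubtypeHom N θ) (comapCoeffHom X N θ) 1 (conjMap X N (g i) 1 a)) := fun i => by
    rw [← map_resCoindFinHomR_shapiroLift X N θ hN hs hs1 hsD hsD1 (g i) a]
    obtain ⟨F, hF⟩ := oneCocycleClass_surjective _ (shapiroLift X N hN hs hs1 a)
    rw [← hF, map_oneCocycleClass, map_oneCocycleClass, map_oneCocycleClass]
    rfl
  simpa only [hfac] using h1

/-! ## §5 (appended) Orbit representatives EXIST: the `hbij` hypothesis of §3–§4 is always satisfiable -/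

/-- **Orbit representatives of the `D`-action on `G ⧸ N` exist** (the `hbij` supplier of `resCoindFinHomR_jointly_bijective`,
`exists_cohomologyMap_resCoindFinHomR_eq`, `cupProduct_map_shapiroLift_eq_sum_orbits` and of the companion's
`map_cupProduct_coindFin_shapiroLift_sum`): for `N ⊴ G` normal of finite index and any `θ : D →ₜ* G` there are a FINITE index type `ι`
and `g : ι → G` with `(i, y') ↦ ē(y')·(g_i N)` a bijection `ι × (D ⧸ θ⁻¹N) ≃ G ⧸ N`. Proof: in the finite group `Ḡ = G ⧸ N` let
`H̄ = θ(D)N/N` (the image of `ē`, onto which `ē` is injective); take `ι := Ḡ ⧸ H̄` and `g_i` a lift of `s(i)⁻¹` for a section `s`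
of `Ḡ → Ḡ ⧸ H̄` — every `y ∈ Ḡ` is uniquely `h · s(i)⁻¹` with `h ∈ H̄` (`i = [y⁻¹]`), i.e. the `g_i N` represent the double cosets
`θ(D) \ G / N`. [cite: Brown1982, III §5 (5.6)(b)] [cite: NeukirchSchmidtWingberg2008, I §5 (1.5.6)–(1.5.7)] -/
theorem exists_orbitReps_bijective (N : Subgroup G) [N.Normal] [N.FiniteIndex] (θ : D →ₜ* G) :
    ∃ (ι : Type v) (_ : Fintype ι) (g : ι → G),
      Function.Bijective fun q : ι × (D ⧸ N.comap (θ : D →* G)) => quotientMapOfHom N θ q.2 * (g q.1 : G ⧸ N) := by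
  classical
  -- the image `H̄` of `D` in `Ḡ := G ⧸ N`
  let π : D →* G ⧸ N := (QuotientGroup.mk' N).comp (θ : D →* G)
  let Hbar : Subgroup (G ⧸ N) := π.range
  have hē : ∀ y' : D ⧸ N.comap (θ : D →* G), quotientMapOfHom N θ y' ∈ Hbar := fun y' => by
    induction y' using QuotientGroup.induction_on with
    | H d => exact ⟨d, by rw [quotientMapOfHom_mk]; rfl⟩
  have hē' : ∀ h ∈ Hbar, ∃ y' : D ⧸ N.comap (θ : D →* G), quotientMapOfHom N θ y' = h := by
    rintro _ ⟨d, rfl⟩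
    exact ⟨(d : D ⧸ N.comap (θ : D →* G)), by rw [quotientMapOfHom_mk]; rfl⟩
  have hēmul : ∀ y₁ y₂ : D ⧸ N.comap (θ : D →* G),
      (quotientMapOfHom N θ y₁)⁻¹ * quotientMapOfHom N θ y₂ ∈ Hbar := fun y₁ y₂ =>
    Hbar.mul_mem (Hbar.inv_mem (hē y₁)) (hē y₂)
  -- `ι := Ḡ ⧸ H̄`, `g i :=` a lift of `(out i)⁻¹`
  let ι : Type v := (G ⧸ N) ⧸ Hbar
  letI : Fintype ι := Fintype.ofFinite ι
  let s : ι → G ⧸ N := Quotient.out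
  have hs : ∀ i : ι, (s i : ι) = i := fun i => Quotient.out_eq i
  let g : ι → G := fun i => ((s i)⁻¹ : G ⧸ N).out
  have hg : ∀ i : ι, ((g i : G) : G ⧸ N) = (s i)⁻¹ := fun i => QuotientGroup.out_eq' _
  refine ⟨ι, inferInstance, g, fun q₁ q₂ h => ?_, fun y => ?_⟩
  · -- injectivity: compare the `H̄`-cosets of the inverses, then cancel and use the injectivity of `ē`
    obtain ⟨i₁, y₁⟩ := q₁
    obtain ⟨i₂, y₂⟩ := q₂
    have h' : quotientMapOfHom N θ y₁ * (s i₁)⁻¹ = quotientMapOfHom N θ y₂ * (s i₂)⁻¹ := by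
      simpa only [hg] using h
    have hi : i₁ = i₂ := by
      rw [← hs i₁, ← hs i₂]
      refine QuotientGroup.eq.mpr ?_
      have e : (s i₁)⁻¹ * s i₂ = (quotientMapOfHom N θ y₁)⁻¹ * quotientMapOfHom N θ y₂ := by
        calc (s i₁)⁻¹ * s i₂ = (quotientMapOfHom N θ y₁)⁻¹ * (quotientMapOfHom N θ y₁ * (s i₁)⁻¹) * s i₂ := by group
          _ = (quotientMapOfHom N θ y₁)⁻¹ * (quotientMapOfHom N θ y₂ * (s i₂)⁻¹) * s i₂ := by rw [h']
          _ = (quotientMapOfHom N θ y₁)⁻¹ * quotientMapOfHom N θ y₂ := by group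
      rw [e]
      exact hēmul y₁ y₂
    subst hi
    have hy : quotientMapOfHom N θ y₁ = quotientMapOfHom N θ y₂ := mul_right_cancel h'
    rw [quotientMapOfHom_injective N θ hy]
  · -- surjectivity: `i := [y⁻¹]`, then `y · s(i) ∈ H̄`
    let i : ι := ((y⁻¹ : G ⧸ N) : ι)
    have hmem : y * s i ∈ Hbar := by
      have e : ((y⁻¹ : G ⧸ N) : ι) = (s i : ι) := (hs i).symm
      have h1 := QuotientGroup.eq.mp e
      simpa only [inv_inv] using h1
    obtain ⟨y', hy'⟩ := hē' _ hmem
    refine ⟨(i, y'), ?_⟩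
    change quotientMapOfHom N θ y' * ((g i : G) : G ⧸ N) = y
    rw [hg, hy', mul_assoc, mul_inv_cancel, mul_one]

/-! ## §6 (appended) Orbit splitting of the cup product of TWO classes of `D` with coefficients `Maps(G ⧸ N, ·)|_θ` -/

/-- **Orbit splitting of the `D`-cup product on `θ^* Maps(G ⧸ N, ·)`, BOTH factors arbitrary classes of `D`**: for orbit representatives
`g : ι → G` and `x ∈ H¹(D, Maps(G ⧸ N, X)|_θ)`, `u ∈ H¹(D, Maps(G ⧸ N, Y)|_θ)`,
`x ∪_{ΣP|_θ} u = Σ_i H¹(Φ_{g_i N}) x ∪_{ΣP|_θ, θ⁻¹N} H¹(Φ_{g_i N}) u` in `H²(D, Z|_θ)` — naturality of the cup product along the family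
`(Φ_{g_i N}, Φ_{g_i N})` over `id_D` (`cupProduct_mapPair_sum`; the summed pairing splits along the orbits, `coindFin_toLin_sum_resCoindFinHomR`).
§4 is the case `x = θ^*(Sh a)`. This is the identity through which the LOCAL Tate pairing of `Maps(G ⧸ N, M)` at a place with several
orbits is the sum of the layer pairings of the components. [cite: NeukirchSchmidtWingberg2008, I §5 Prop. (1.5.3) (iv), (1.5.6)–(1.5.7)]
[cite: Brown1982, III §5 (5.6)(b), V §3] -/
theorem cupProduct_restrict_coindFin_eq_sum_orbits [IsTopologicalGroup G] [IsTopologicalGroup D] [LocallyCompactSpace G]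
    [LocallyCompactSpace D] {X Y Z : TopRep.{v} R G} (P : ContPairing X Y Z) (N : Subgroup G) [N.Normal] (θ : D →ₜ* G)
    [Fintype (G ⧸ N)] [Fintype (D ⧸ N.comap (θ : D →* G))] {ι : Type w} [Fintype ι] (g : ι → G)
    (hbij : Function.Bijective fun q : ι × (D ⧸ N.comap (θ : D →* G)) => quotientMapOfHom N θ q.2 * (g q.1 : G ⧸ N))
    (x : continuousCohomology 1 (TopRep.res (θ : D →* G) (coindFin X N)))
    (u : continuousCohomology 1 (TopRep.res (θ : D →* G) (coindFin Y N))) :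
    ((P.coindFin N).restrict θ).cupProduct x u =
      ∑ i, ((P.restrict θ).coindFin (N.comap (θ : D →* G))).cupProduct
        (cohomologyMap (resCoindFinHomR X N θ (g i : G ⧸ N)) 1 x) (cohomologyMap (resCoindFinHomR Y N θ (g i : G ⧸ N)) 1 u) := by
  have h1 := ContPairing.cupProduct_mapPair_sum Finset.univ ((P.coindFin N).restrict θ)
    ((P.restrict θ).coindFin (N.comap (θ : D →* G))) (ContinuousMonoidHom.id D)
    (fun i => resIdHom (resCoindFinHomR X N θ (g i : G ⧸ N))) (fun i => resIdHom (resCoindFinHomR Y N θ (g i : G ⧸ N)))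
    (𝟙 (TopRep.res (θ : D →* G) Z))
    (fun F F' => by
      change (P.coindFin N).toLin F F' = _
      rw [ContPairing.coindFin_toLin_sum_resCoindFinHomR P N θ (fun i => (g i : G ⧸ N)) hbij F F']
      rfl)
    x u
  rw [ContinuousCohomology.map_id] at h1
  exact h1

end Literature.NumberTheory.GaloisRepresentations

end
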